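import Summits.BirchSwinnertonDyer.BirchSwinnertonDyer.Theorems.EisensteinPrimesMazurMCOnCellBTwistbackKLFieldSupply
import Summits.BirchSwinnertonDyer.BirchSwinnertonDyer.Theorems.EisensteinPrimesMazurMCOnCellBTwistbackKLFieldSupplyClassNumber
import HarnessLib

/-!
# Crux 3 `MazurMCOnCellB` (stmt-BirchSwinnertonDyer-19033), line `twistback` v4 — road (d) into stub 6:
# the ADMISSIBLE FIELD with the door's class number, ONE theorem modulo ONE published fact (Nakagawa–Horie–Taya)

Width seat bsd-line-x2-p1-w6 (g0), 2026-08-28. HONEST FRAMING (cell `bsd-eis`, run/shared/lean/pub/bsd-eis/): a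
conditional theorem (THEOREMS ONLY; no definition, no new named fact, no `sorry`); the only named input is the
PUBLISHED density fact `Literature.NumberTheory.QuadraticFields.nakagawaHorie_taya_exists_imaginary_h3_eq_one`
(Nakagawa–Horie 1988 Thm. 1 + Taya 2000, as Kriz–Li 2019 Thm. 9.2 / Prop. 9.3; p650412); nothing is booked; no main
conjecture / BSD is proved for any curve; 0 cells / labels / tiers move; no summit statement is proved by this seat.

The composition of the field supply (p650415 `…TwistbackKLFieldSupply.exists_heegnerField_threeClassNumberTrivial`, at
`A = N_W`) with the class-number dictionary (p650743 `…TwistbackKLFieldSupplyClassNumber.not_three_dvd_classNumber_mul`):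
for every elliptic `W/ℚ` and every positive fundamental discriminant `D` there is an imaginary quadratic `K` with the
Heegner hypothesis for `N_W`, for `3` and for `2`, `d_K` odd `< −4`, `gcd(d_K, D) = 1`, **`3 ∤ h(D·d_K)`**
(`BinaryQuadraticForm.classNumber`, the currency of w3 g7's Bernoulli-unit criterion
`norm_twistedBernoulli_teichmullerLift_inv_eq_one_iff_three` feeding LEAD g10's p645771 `klFlat_of_norm_twistedBernoulli_eq_one`)
and `4 < D·|d_K|` — EVERY hypothesis on `K` of the KL-flat door p645525 §3 / p645771 §3 except the analytic rank of the
twist (road (d′), w5 p649897; or per pair a Heegner point of infinite order, w6 p649483 §2) and the carrier's line data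
(w3 g8's dictionary p648132/p648554/p649377/p650230, w7's p649032/p650111).

References: [NakagawaHorie1988] Thm. 1; [KrizLi2019] §9 (Def. 9.1, Thm. 9.2, Prop. 9.3, proof of Thm. 9.4);
[Cox2013] Thm. 7.7 (ii); [Marcus2018] Ch. 2 Thm. 1, Ch. 3 Thm. 25.
-/

set_option autoImplicit false

-- `Summit.BirchSwinnertonDyer.BirchSwinnertonDyer.…`: the summit and its single sub-problem share a name.
set_option linter.dupNamespace false

noncomputable section

open scoped Classical

open WeierstrassCurve NumberField
  Literature.NumberTheory.EllipticCurves
  Literature.NumberTheory.EllipticCurves.KrizLi2019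
  Literature.NumberTheory.QuadraticFields
  Summit.BirchSwinnertonDyer.BirchSwinnertonDyer.Theorems.EisensteinPrimesMazurMCOnCellBTwistbackKLFieldSupply
  Summit.BirchSwinnertonDyer.BirchSwinnertonDyer.Theorems.EisensteinPrimesMazurMCOnCellBTwistbackKLFieldSupplyClassNumber

namespace Summit.BirchSwinnertonDyer.BirchSwinnertonDyer.Theorems.EisensteinPrimesMazurMCOnCellBTwistbackKLFieldSupplyAdmissible

/-- **THE ADMISSIBLE FIELD WITH THE DOOR'S CLASS NUMBER, from print.** For `W/ℚ` elliptic of conductor `N_W` and a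
positive fundamental discriminant `D`: there is an imaginary quadratic `K` with `SatisfiesHeegnerHypothesis N_W K`,
`SatisfiesHeegnerHypothesis 3 K`, `SatisfiesHeegnerHypothesis 2 K`, `d_K` odd, `d_K < −4`,
`d_K ≡ 1 (mod 24·N_W·D)` (so `χ_{d_K}(ℓ) = 1` at every `ℓ ∣ 6·N_W·D`), `IsCoprime d_K D`, `ThreeClassNumberTrivial (D·d_K)`,
`¬ 3 ∣ BinaryQuadraticForm.classNumber (D · d_K)` and `4 < (D · d_K).natAbs`. Proof: the supply at `A = N_W` gives `K`
with `d_K ≡ 1 (mod 24·N_W·D)` (whence coprime to `D`), every prime of `24·N_W·|D|` split, `d_K < −4`, and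
`ThreeClassNumberTrivial (D·d_K)`; `d_K` is `≡ 1 (mod 4)` squarefree (a fundamental discriminant,
`Quadratic.isFundamentalDiscriminant_discr`, odd); the dictionary converts the class number. CONDITIONAL on the named
fact `hNH`. [cite: KrizLi2019, Thm. 9.4 (first assertion) and its proof (§9)] [cite: NakagawaHorie1988, Thm. 1]
[cite: Cox2013, Thm. 7.7 (ii)] -/
theorem exists_admissibleField_not_three_dvd_classNumber
    (hNH : Literature.NumberTheory.QuadraticFields.nakagawaHorie_taya_exists_imaginary_h3_eq_one)
    (W : WeierstrassCurve ℚ) [W.IsElliptic] {D : ℤ} (hD0 : 0 < D)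
    (hDf : (D % 4 = 1 ∧ Squarefree D ∧ D ≠ 1) ∨ (4 ∣ D ∧ (D / 4 % 4 = 2 ∨ D / 4 % 4 = 3) ∧ Squarefree (D / 4))) :
    ∃ (K : Type) (_ : Field K) (_ : NumberField K), IsImaginaryQuadratic K ∧
      SatisfiesHeegnerHypothesis (W.conductorNorm ℤ) K ∧ SatisfiesHeegnerHypothesis 3 K ∧
      SatisfiesHeegnerHypothesis 2 K ∧ Odd (NumberField.discr K) ∧ NumberField.discr K < -4 ∧
      NumberField.discr K ≡ 1 [ZMOD (24 * (W.conductorNorm ℤ : ℤ) * D)] ∧ IsCoprime (NumberField.discr K) D ∧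
      ThreeClassNumberTrivial (D * NumberField.discr K) ∧
      ¬ 3 ∣ BinaryQuadraticForm.classNumber (D * NumberField.discr K) ∧ 4 < (D * NumberField.discr K).natAbs := by
  have hN : 0 < W.conductorNorm ℤ := W.conductorNorm_pos_holds
  obtain ⟨K, _, _, hK, -, hlt, hmod, hodd, hH, h3⟩ :=
    exists_heegnerField_threeClassNumberTrivial hNH hD0 hDf hN 0
  obtain ⟨t, ht⟩ := Int.modEq_iff_dvd.mp hmod.symm
  have hcop : IsCoprime (NumberField.discr K) D :=
    ⟨1, -(24 * (W.conductorNorm ℤ : ℤ) * t), by linear_combination ht⟩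
  -- `d_K ≡ 1 (mod 4)` and squarefree (fundamental and odd)
  have hfund := Quadratic.isFundamentalDiscriminant_discr (K := K) hK.1
  have hodd4 : ¬ (4 : ℤ) ∣ NumberField.discr K := fun h4 ↦ by
    obtain ⟨k, hk⟩ := hodd
    omega
  obtain ⟨hd4, hdsf, -⟩ := hfund.resolve_right fun h ↦ hodd4 h.1
  obtain ⟨h3', h4'⟩ := not_three_dvd_classNumber_mul hD0 hDf hlt hd4 hdsf hcop h3
  exact ⟨K, inferInstance, inferInstance, hK, hH.of_dvd ⟨24 * D.natAbs, by ring⟩,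
    hH.of_dvd ⟨8 * (W.conductorNorm ℤ) * D.natAbs, by ring⟩, hH.of_dvd ⟨12 * (W.conductorNorm ℤ) * D.natAbs, by ring⟩,
    hodd, hlt, hmod, hcop, h3, h3', h4'⟩

end Summit.BirchSwinnertonDyer.BirchSwinnertonDyer.Theorems.EisensteinPrimesMazurMCOnCellBTwistbackKLFieldSupplyAdmissible

end
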